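import Mathlib

/-!
# The reduced two-spin family near a corner umbilic point: triple degeneracies and non-scalarity

Finite algebraic facts behind case (γ) of the non-umbilicity condition (NU₃) for the reduced
family of the three-spin block at the corner / `B_X` charts,
[cite: ImbrieJSP2016, eq. (1.1), assumption LLA(ν, C)]  Repair cell b2b-imbrie, LLA.md block Q8(b)
((Ω-T-rel₃) and the (NU₃) case list), refereed in REFEREE.md G276.
J. Z. Imbrie, *On many-body localization for quantum spin chains*,
J. Stat. Phys. 163 (2016) 998–1048, arXiv:1403.7837 (Theorem 1.1, Assumption LLA).

The reduced family is the two-spin block with unit coupling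
`𝔥₁(ζ) = ζ₁ Z⊗1 + ζ₂ X⊗1 + ζ₃ 1⊗Z + ζ₄ 1⊗X + Z⊗Z` on `ℝ² ⊗ ℝ²`, written as the real symmetric
`4 × 4` matrix `hOne ζ₁ ζ₂ ζ₃ ζ₄` in the basis `|++⟩, |+−⟩, |−+⟩, |−−⟩` (first sign = `σ₁`).

* `rankOne_classification`: if `𝔥₁(ζ) − λ` has rank `≤ 1` (witnessed as an outer product
  `a bᵀ`; this holds whenever `λ` is an eigenvalue of multiplicity `≥ 3`), then `ζ₂ = ζ₄ = 0`,
  `ζ₁ = τ ∈ {±1}`, `ζ₃ = s ∈ {±1}` and `λ = −sτ` — the triple degeneracies of the reduced family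
  form exactly the four-point set `ζ = (τ, 0, s, 0)` of LLA.md Q8(b)(γ).
* `rankOne_at_corner`: conversely at `ζ = (τ, 0, s, 0)`, `𝔥₁ + sτ` is the rank-one matrix
  `4sτ · e_{(s,τ)} e_{(s,τ)}ᵀ` (so the triple eigenspace is `E₃ = {|s⟩⊗|τ⟩}^⊥`), via the
  factorisation `τσ₁ + sσ₂ + σ₁σ₂ + sτ = (σ₁ + s)(σ₂ + τ)` (`diag_factor`).
* `nonscalar_on_every_plane`: (NU₃) at these points.  In the orthonormal basis
  `e₀ = |s,−τ⟩, e₁ = |−s,τ⟩, e₂ = |−s,−τ⟩` of `E₃` the swept direction `Z⊗1` acts as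
  `A = s·diag(1,−1,−1)` and `D_φ = cos φ·1⊗Z + sin φ·1⊗X` compresses to
  `D = cos φ·τ·diag(−1,1,−1) + sin φ·(E₁₂ + E₂₁)`.  For NO orthonormal pair `v, w ∈ E₃` are both
  compressions to `span{v,w}` scalar (`⟨v,Ov⟩ = ⟨w,Ow⟩`, `⟨v,Ow⟩ = 0` for `O = A` and `O = D`):
  the statement is proved as the polynomial implication it unfolds to.

No spectral theory is used; everything is polynomial algebra over `ℝ`.
-/

namespace Literature.MathematicalPhysics.QuantumLattice.Imbrie2016.TripleDegeneracy

/-- [cite: ImbrieJSP2016, eq. (1.1)] The reduced two-spin family with unit `ZZ` coupling,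
`ζ₁ Z⊗1 + ζ₂ X⊗1 + ζ₃ 1⊗Z + ζ₄ 1⊗X + Z⊗Z`, basis `|++⟩, |+−⟩, |−+⟩, |−−⟩`. -/
def hOne (ζ₁ ζ₂ ζ₃ ζ₄ : ℝ) : Matrix (Fin 4) (Fin 4) ℝ :=
  !![ζ₁ + ζ₃ + 1, ζ₄, ζ₂, 0;
     ζ₄, ζ₁ - ζ₃ - 1, 0, ζ₂;
     ζ₂, 0, -ζ₁ + ζ₃ - 1, ζ₄;
     0, ζ₂, ζ₄, -ζ₁ - ζ₃ + 1]

/-- [cite: ImbrieJSP2016, eq. (1.1)] The diagonal of `𝔥₁(τ,0,s,0) + sτ` factorises: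
`τσ₁ + sσ₂ + σ₁σ₂ + sτ = (σ₁ + s)(σ₂ + τ)`, which for `s, τ, σᵢ ∈ {±1}` vanishes unless
`(σ₁, σ₂) = (s, τ)`. -/
theorem diag_factor (τ s σ₁ σ₂ : ℝ) :
    τ * σ₁ + s * σ₂ + σ₁ * σ₂ + s * τ = (σ₁ + s) * (σ₂ + τ) := by ring

/-- [cite: ImbrieJSP2016, eq. (1.1), assumption LLA(ν, C)] TRIPLE DEGENERACIES OF THE REDUCED
FAMILY (LLA.md Q8(b)(γ)).  If `𝔥₁(ζ) − λ·1 = a bᵀ` has rank `≤ 1`, then `ζ₂ = ζ₄ = 0` and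
`(ζ₁, ζ₃, λ) = (τ, s, −sτ)` with `τ, s ∈ {±1}`. -/
theorem rankOne_classification (ζ₁ ζ₂ ζ₃ ζ₄ l : ℝ) (a b : Fin 4 → ℝ)
    (h : ∀ i j, (hOne ζ₁ ζ₂ ζ₃ ζ₄ - l • (1 : Matrix (Fin 4) (Fin 4) ℝ)) i j = a i * b j) :
    ζ₂ = 0 ∧ ζ₄ = 0 ∧
      ((ζ₁ = 1 ∧ ζ₃ = 1 ∧ l = -1) ∨ (ζ₁ = 1 ∧ ζ₃ = -1 ∧ l = 1) ∨
        (ζ₁ = -1 ∧ ζ₃ = 1 ∧ l = 1) ∨ (ζ₁ = -1 ∧ ζ₃ = -1 ∧ l = -1)) := by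
  -- the sixteen entries
  have h00 : a 0 * b 0 = ζ₁ + ζ₃ + 1 - l := by rw [← h 0 0]; simp [hOne]
  have h11 : a 1 * b 1 = ζ₁ - ζ₃ - 1 - l := by rw [← h 1 1]; simp [hOne]
  have h22 : a 2 * b 2 = -ζ₁ + ζ₃ - 1 - l := by rw [← h 2 2]; simp [hOne]
  have h33 : a 3 * b 3 = -ζ₁ - ζ₃ + 1 - l := by rw [← h 3 3]; simp [hOne]
  have h01 : a 0 * b 1 = ζ₄ := by rw [← h 0 1]; simp [hOne]
  have h10 : a 1 * b 0 = ζ₄ := by rw [← h 1 0]; simp [hOne]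
  have h23 : a 2 * b 3 = ζ₄ := by rw [← h 2 3]; simp [hOne]
  have h32 : a 3 * b 2 = ζ₄ := by rw [← h 3 2]; simp [hOne]
  have h02 : a 0 * b 2 = ζ₂ := by rw [← h 0 2]; simp [hOne]
  have h20 : a 2 * b 0 = ζ₂ := by rw [← h 2 0]; simp [hOne]
  have h13 : a 1 * b 3 = ζ₂ := by rw [← h 1 3]; simp [hOne]
  have h31 : a 3 * b 1 = ζ₂ := by rw [← h 3 1]; simp [hOne]
  have h03 : a 0 * b 3 = 0 := by rw [← h 0 3]; simp [hOne]
  have h30 : a 3 * b 0 = 0 := by rw [← h 3 0]; simp [hOne]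
  have h12 : a 1 * b 2 = 0 := by rw [← h 1 2]; simp [hOne]
  have h21 : a 2 * b 1 = 0 := by rw [← h 2 1]; simp [hOne]
  -- ζ₄² = (a₀b₁)(a₂b₃) = (a₀b₃)(a₂b₁) = 0, ζ₂² = (a₀b₂)(a₁b₃) = (a₀b₃)(a₁b₂) = 0
  have hz4sq : ζ₄ ^ 2 = 0 := by
    linear_combination (-(a 2 * b 3)) * h01 + (-ζ₄) * h23 + (a 2 * b 1) * h03
  have hz2sq : ζ₂ ^ 2 = 0 := by
    linear_combination (-(a 1 * b 3)) * h02 + (-ζ₂) * h13 + (a 1 * b 2) * h03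
  have hz4 : ζ₄ = 0 := pow_eq_zero_iff (two_ne_zero) |>.mp hz4sq
  have hz2 : ζ₂ = 0 := pow_eq_zero_iff (two_ne_zero) |>.mp hz2sq
  refine ⟨hz2, hz4, ?_⟩
  rw [hz4] at h01 h10 h23 h32
  rw [hz2] at h02 h20 h13 h31
  -- products of diagonal entries vanish: DᵢDⱼ = (aᵢbᵢ)(aⱼbⱼ) = (aᵢbⱼ)(aⱼbᵢ) = 0
  have p01 : (ζ₁ + ζ₃ + 1 - l) * (ζ₁ - ζ₃ - 1 - l) = 0 := by
    rw [← h00, ← h11]; linear_combination (a 1 * b 0) * h01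
  have p02 : (ζ₁ + ζ₃ + 1 - l) * (-ζ₁ + ζ₃ - 1 - l) = 0 := by
    rw [← h00, ← h22]; linear_combination (a 2 * b 0) * h02
  have p03 : (ζ₁ + ζ₃ + 1 - l) * (-ζ₁ - ζ₃ + 1 - l) = 0 := by
    rw [← h00, ← h33]; linear_combination (a 3 * b 0) * h03
  have p12 : (ζ₁ - ζ₃ - 1 - l) * (-ζ₁ + ζ₃ - 1 - l) = 0 := by
    rw [← h11, ← h22]; linear_combination (a 2 * b 1) * h12
  have p13 : (ζ₁ - ζ₃ - 1 - l) * (-ζ₁ - ζ₃ + 1 - l) = 0 := by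
    rw [← h11, ← h33]; linear_combination (a 3 * b 1) * h13
  have p23 : (-ζ₁ + ζ₃ - 1 - l) * (-ζ₁ - ζ₃ + 1 - l) = 0 := by
    rw [← h22, ← h33]; linear_combination (a 3 * b 2) * h23
  -- at most one diagonal entry of 𝔥₁ − λ is non-zero
  rcases mul_eq_zero.mp p01 with d0 | d1
  · rcases mul_eq_zero.mp p23 with d2 | d3
    · rcases mul_eq_zero.mp p13 with d1 | d3
      · -- D₀ = D₁ = D₂ = 0
        exact Or.inr (Or.inr (Or.inr ⟨by linarith, by linarith, by linarith⟩))
      · -- D₀ = D₂ = D₃ = 0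
        exact Or.inr (Or.inr (Or.inl ⟨by linarith, by linarith, by linarith⟩))
    · rcases mul_eq_zero.mp p12 with d1 | d2
      · -- D₀ = D₁ = D₃ = 0
        exact Or.inr (Or.inl ⟨by linarith, by linarith, by linarith⟩)
      · -- D₀ = D₂ = D₃ = 0
        exact Or.inr (Or.inr (Or.inl ⟨by linarith, by linarith, by linarith⟩))
  · rcases mul_eq_zero.mp p23 with d2 | d3
    · rcases mul_eq_zero.mp p03 with d0 | d3
      · -- D₀ = D₁ = D₂ = 0
        exact Or.inr (Or.inr (Or.inr ⟨by linarith, by linarith, by linarith⟩))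
      · -- D₁ = D₂ = D₃ = 0
        exact Or.inl ⟨by linarith, by linarith, by linarith⟩
    · rcases mul_eq_zero.mp p02 with d0 | d2
      · -- D₀ = D₁ = D₃ = 0
        exact Or.inr (Or.inl ⟨by linarith, by linarith, by linarith⟩)
      · -- D₁ = D₂ = D₃ = 0
        exact Or.inl ⟨by linarith, by linarith, by linarith⟩

/-- [cite: ImbrieJSP2016, eq. (1.1), assumption LLA(ν, C)] Conversely, at `ζ = (τ, 0, s, 0)`
with `τ, s ∈ {±1}`, `𝔥₁ + sτ·1` is a rank-one matrix (one non-zero diagonal entry `4sτ` at the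
basis vector `|s⟩⊗|τ⟩`), so `−sτ` is an eigenvalue of multiplicity exactly three with eigenspace
`{|s⟩⊗|τ⟩}^⊥`. -/
theorem rankOne_at_corner (τ s : ℝ) (hτ : τ = 1 ∨ τ = -1) (hs : s = 1 ∨ s = -1) :
    ∃ a b : Fin 4 → ℝ, ∀ i j,
      (hOne τ 0 s 0 - (-(s * τ)) • (1 : Matrix (Fin 4) (Fin 4) ℝ)) i j = a i * b j := by
  rcases hτ with rfl | rfl <;> rcases hs with rfl | rfl
  · exact ⟨![4, 0, 0, 0], ![1, 0, 0, 0], by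
      intro i j; fin_cases i <;> fin_cases j <;> norm_num [hOne]⟩
  · exact ⟨![0, 0, -4, 0], ![0, 0, 1, 0], by
      intro i j; fin_cases i <;> fin_cases j <;> norm_num [hOne]⟩
  · exact ⟨![0, -4, 0, 0], ![0, 1, 0, 0], by
      intro i j; fin_cases i <;> fin_cases j <;> norm_num [hOne]⟩
  · exact ⟨![0, 0, 0, 4], ![0, 0, 0, 1], by
      intro i j; fin_cases i <;> fin_cases j <;> norm_num [hOne]⟩

/-- [cite: ImbrieJSP2016, eq. (1.1), assumption LLA(ν, C)] (NU₃) AT THE TRIPLE POINTS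
(LLA.md Q8(b)(γ)).  In the orthonormal basis `e₀ = |s,−τ⟩, e₁ = |−s,τ⟩, e₂ = |−s,−τ⟩` of the
triple eigenspace `E₃`, `Z⊗1` acts as `A = s·diag(1,−1,−1)` and `D_φ = cos φ·1⊗Z + sin φ·1⊗X`
compresses to `D = cτ·diag(−1,1,−1) + σ·(E₁₂ + E₂₁)` (`c = cos φ`, `σ = sin φ`).  For an
orthonormal pair `v, w ∈ E₃` the compressions of `A` and `D` to `span{v, w}` cannot both be
scalar: the four scalarity equations `⟨v,Av⟩ = ⟨w,Aw⟩`, `⟨v,Aw⟩ = 0`, `⟨v,Dv⟩ = ⟨w,Dw⟩`,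
`⟨v,Dw⟩ = 0` are contradictory.  (`A` forces `v₀ = w₀ = 0`, i.e. the plane `{e₀}^⊥ = |−s⟩⊗ℝ²`,
on which `D` is the traceless non-zero `cτ Z + σ X`.) -/
theorem nonscalar_on_every_plane (s τ c σ : ℝ) (hs : s ^ 2 = 1) (hτ : τ ^ 2 = 1)
    (hcσ : c ^ 2 + σ ^ 2 = 1) (v₀ v₁ v₂ w₀ w₁ w₂ : ℝ)
    (hv : v₀ ^ 2 + v₁ ^ 2 + v₂ ^ 2 = 1) (hw : w₀ ^ 2 + w₁ ^ 2 + w₂ ^ 2 = 1)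
    (hvw : v₀ * w₀ + v₁ * w₁ + v₂ * w₂ = 0)
    (hA1 : s * (v₀ ^ 2 - v₁ ^ 2 - v₂ ^ 2) = s * (w₀ ^ 2 - w₁ ^ 2 - w₂ ^ 2))
    (hA2 : s * (v₀ * w₀ - v₁ * w₁ - v₂ * w₂) = 0)
    (hD1 : c * τ * (-v₀ ^ 2 + v₁ ^ 2 - v₂ ^ 2) + 2 * σ * v₁ * v₂
      = c * τ * (-w₀ ^ 2 + w₁ ^ 2 - w₂ ^ 2) + 2 * σ * w₁ * w₂)
    (hD2 : c * τ * (-(v₀ * w₀) + v₁ * w₁ - v₂ * w₂) + σ * (v₁ * w₂ + v₂ * w₁) = 0) :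
    False := by
  have hs0 : s ≠ 0 := by rintro rfl; norm_num at hs
  have hτ0 : τ ≠ 0 := by rintro rfl; norm_num at hτ
  -- A scalar on the plane forces v₀ = w₀ = 0
  have e1 : s * (2 * (v₀ * w₀)) = 0 := by linear_combination hA2 + s * hvw
  have e1' : v₀ * w₀ = 0 := by
    rcases mul_eq_zero.mp e1 with h | h
    · exact absurd h hs0
    · linarith
  have e2 : s * (2 * v₀ ^ 2 - 2 * w₀ ^ 2) = 0 := by
    linear_combination hA1 + s * hv - s * hw
  have e2' : v₀ ^ 2 = w₀ ^ 2 := by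
    rcases mul_eq_zero.mp e2 with h | h
    · exact absurd h hs0
    · linarith
  have hv0 : v₀ = 0 := by
    rcases mul_eq_zero.mp e1' with h | h
    · exact h
    · rw [h] at e2'; simpa using e2'
  have hw0 : w₀ = 0 := by
    rcases mul_eq_zero.mp e1' with h | h
    · rw [h] at e2'; simpa using e2'.symm
    · exact h
  subst hv0; subst hw0
  -- in the plane {e₀}^⊥: w = δ (−v₂, v₁) with δ² = 1
  have hv' : v₁ ^ 2 + v₂ ^ 2 = 1 := by linear_combination hv
  have hw' : w₁ ^ 2 + w₂ ^ 2 = 1 := by linear_combination hw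
  have hvw' : v₁ * w₁ + v₂ * w₂ = 0 := by linear_combination hvw
  obtain ⟨δ, hδdef⟩ : ∃ δ : ℝ, δ = v₁ * w₂ - v₂ * w₁ := ⟨_, rfl⟩
  have hδ : δ ^ 2 = 1 := by
    rw [hδdef]; linear_combination (w₁ ^ 2 + w₂ ^ 2) * hv' + hw' - (v₁ * w₁ + v₂ * w₂) * hvw'
  have hw1 : w₁ = -δ * v₂ := by
    rw [hδdef]; linear_combination (-w₁) * hv' + v₁ * hvw'
  have hw2 : w₂ = δ * v₁ := by
    rw [hδdef]; linear_combination (-w₂) * hv' + v₂ * hvw'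
  rw [hw1, hw2] at hD1 hD2
  -- D scalar on the plane gives cτ·p + σ·q = 0 and σ·p − cτ·q = 0 with p² + q² = 1
  have hP : c * τ * (v₁ ^ 2 - v₂ ^ 2) + σ * (2 * v₁ * v₂) = 0 := by
    linear_combination (1 / 2 : ℝ) * hD1
      + (-(1 / 2 : ℝ) * (c * τ * (v₁ ^ 2 - v₂ ^ 2) + σ * (2 * v₁ * v₂))) * hδ
  have hQ : σ * (v₁ ^ 2 - v₂ ^ 2) - c * τ * (2 * v₁ * v₂) = 0 := by
    linear_combination δ * hD2 + (-(σ * (v₁ ^ 2 - v₂ ^ 2) - c * τ * (2 * v₁ * v₂))) * hδ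
  have hpq : (v₁ ^ 2 - v₂ ^ 2) ^ 2 + (2 * v₁ * v₂) ^ 2 = 1 := by
    linear_combination (v₁ ^ 2 + v₂ ^ 2 + 1) * hv'
  have hcτ : c * τ = 0 := by
    linear_combination (v₁ ^ 2 - v₂ ^ 2) * hP - (2 * v₁ * v₂) * hQ + (-(c * τ)) * hpq
  have hσ0 : σ = 0 := by
    linear_combination (2 * v₁ * v₂) * hP + (v₁ ^ 2 - v₂ ^ 2) * hQ + (-σ) * hpq
  have hc0 : c = 0 := by
    rcases mul_eq_zero.mp hcτ with h | h
    · exact h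
    · exact absurd h hτ0
  rw [hc0, hσ0] at hcσ
  norm_num at hcσ

end Literature.MathematicalPhysics.QuantumLattice.Imbrie2016.TripleDegeneracy
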